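import Summits.HodgeConjecture.HodgeConjecture.Theses.MomentAmplification
import Literature.AlgebraicGeometry.Motives.MotivatedCycles

/-!
# Birth skeleton (BC3) — crux `AlgebraicDensity` of route `MomentAmplification`

Crux item `stmt-HodgeConjecture-11035`, decl
`Summit.HodgeConjecture.HodgeConjecture.Theses.MomentAmplification.AlgebraicDensity`:
for every comparison-compatible Betti–Hodge realization `B` and every smooth projective `X/ℂ`
of dimension `n`, the ALGEBRAIC classes of codimension `nN` on `X^{2N}` have density `> 1/2`
among the Hodge classes there, frequently in `N`.

## The seam (André's decomposition, the rev-3 → rev-4 history of the route made explicit)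

`A^{nN}(X^{2N}) ⊆ A_mot^{nN}(X^{2N}) ⊆ Hdg^{nN}(X^{2N})` (algebraic ⊆ motivated ⊆ Hodge;
André 1996 §2.1, Prop. 2.1, §4). Density `> 1/2` of the smallest space in the largest is split
at the middle term:

* `stub_motivatedDensity` — **the bet, `B`-free core** (the idea card's original form, = the
  route's rev-3 item `MotivatedDensity`, retired MOOT in the rev-4 cone repair only because the
  ROUTE file must not import `Motives/MotivatedCycles`; a Cruxes line may): MOTIVATED classes have
  density `> 1/2` among the Hodge classes of `H^{2nN}(X^{2N})`, frequently in `N`. Via the route's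
  `HalfOrAll` + Tannakian counts (`MT ≤ G_mot`, André §4.6) this is "Hodge = motivated on all
  powers of `X`", the first conjunct of André's reduction `HC ⟸ (Hodge ⇒ motivated) ∧ B`
  [Andre1996Motifs Thm 0.4, 0.6.2]; known for abelian-type `X` (André 0.6.2), open beyond.
* `stub_motivatedLeAlgebraic` — **the `B`-flavoured half**: in the middle degree of the even
  self-powers of `X`, motivated classes are algebraic. Under the route's crux #3 `LefschetzBetti`
  (`= B.W.LefschetzStandardConjecture` unfolded) this IS the discharged named fact
  `WeilCohomology.motivatedClasses_eq_algebraicClasses_of_lefschetzStandardConjecture`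
  (André 1996 §0.3/§2.1 remark p. 14; Kleiman 1968 Prop. 2.3); unconditionally it is of
  standard-conjecture-`B` strength (`A_mot = A` for all varieties ⟺ `B`), restricted here to the
  spaces the crux counts.

`AlgebraicDensity_of` is the real (sorry-free) composition: a frequent lower bound for
`dim A_mot` is a frequent lower bound for `dim A ≥ dim A_mot` (`Submodule.finrank_mono` in the
finite-dimensional `H^{2nN}_B(X^{2N})`, `WeilCohomology.finite_obj`).

Neither stub alone gives the crux (stub 1 lacks `A_mot ⊆ A`, stub 2 carries no count) nor the
summit; both are consequences of `HodgeConjecture` (HC ⇒ `A = A_mot = Hdg`), i.e. consequences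
used toward `S`. BC3 probes (`stub → AlgebraicDensity`, `stub → HodgeConjecture` by
`first | exact? | simpa [·] | (unfold ·; simpa) | aesop`) are run in the sibling probe file and
must fail.
-/

namespace Summit.HodgeConjecture.HodgeConjecture.Cruxes.AlgebraicDensity.Birth

open Literature.AlgebraicGeometry.Motives
open Summit.HodgeConjecture.HodgeConjecture.Theses.MomentAmplification

/-- **Stub 1 statement — motivated density (the bet).** For every comparison-compatible `B` and
every smooth projective `X` of dimension `n` there is `δ > 0` such that, for infinitely many `N`
(with a smooth-projectivity witness `hN` of `X^{2N} := Nat.rec 𝟙 (· ⊗ X) (2N)`, dimension `2Nn`),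
`(1/2 + δ) · dim_ℚ Hdg^{nN}_B(X^{2N}) ≤ dim_ℚ A_mot^{nN}(X^{2N})`
(`B.W.motivatedClasses (2Nn) (X^{2N}) (Nn)`, André 1996 Déf. 1). Same shape as the crux with
motivated in place of algebraic classes. [cite: Andre1996Motifs, Thm 0.4 and 0.6.2, §4.6] -/
def MotivatedDensity : Prop :=
  ∀ B : Literature.AlgebraicGeometry.Motives.BettiHodgeData ℂ, B.IsComparisonCompatible →
    ∀ ⦃n : ℕ⦄ ⦃X : Literature.AlgebraicGeometry.Motives.SchemeOver ℂ⦄,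
      Literature.AlgebraicGeometry.Motives.IsSmoothProjective n X →
        (let pow := (fun k : ℕ => @Nat.rec (fun _ => Literature.AlgebraicGeometry.Motives.SchemeOver ℂ)
          (CategoryTheory.MonoidalCategoryStruct.tensorUnit (Literature.AlgebraicGeometry.Motives.SchemeOver ℂ))
          (fun _ Y => CategoryTheory.MonoidalCategoryStruct.tensorObj Y X) k);
        (∃ δ : ℝ, 0 < δ ∧ ∃ᶠ N in Filter.atTop,
          ∃ hN : Literature.AlgebraicGeometry.Motives.IsSmoothProjective (2 * N * n) (pow (2 * N)),
            (1 / 2 + δ) * ((Module.finrank ℚ ↥((B.hodge hN (2 * (N * n))).hodgeClasses ((N * n : ℕ) : ℤ))) : ℝ) ≤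
              ((Module.finrank ℚ ↥(B.W.motivatedClasses (2 * N * n) (pow (2 * N)) (N * n))) : ℝ)))

/-- **Stub 2 statement — motivated classes are algebraic in the middle degree of the even
self-powers.** For every comparison-compatible `B`, every smooth projective `X` of dimension `n`,
every `N` and every smooth-projectivity witness of `X^{2N}`:
`A_mot^{nN}(X^{2N}) ⊆ ℚ · A^{nN}(X^{2N})` (as `ℚ`-subspaces of `H^{2nN}_B(X^{2N})`). Under
`B(·)` for `B.W` this is André 1996 §0.3 / §2.1 (remark p. 14) with Kleiman 1968 Prop. 2.3 — the
tree's discharged named fact `motivatedClasses_eq_algebraicClasses_of_lefschetzStandardConjecture`;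
unconditionally it is of standard-conjecture-`B` strength. [cite: Andre1996Motifs, §0.3 and §2.1 remark p. 14] [cite: Kleiman1968, Prop. 2.3] -/
def MotivatedLeAlgebraic : Prop :=
  ∀ B : Literature.AlgebraicGeometry.Motives.BettiHodgeData ℂ, B.IsComparisonCompatible →
    ∀ ⦃n : ℕ⦄ ⦃X : Literature.AlgebraicGeometry.Motives.SchemeOver ℂ⦄,
      Literature.AlgebraicGeometry.Motives.IsSmoothProjective n X →
        (let pow := (fun k : ℕ => @Nat.rec (fun _ => Literature.AlgebraicGeometry.Motives.SchemeOver ℂ)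
          (CategoryTheory.MonoidalCategoryStruct.tensorUnit (Literature.AlgebraicGeometry.Motives.SchemeOver ℂ))
          (fun _ Y => CategoryTheory.MonoidalCategoryStruct.tensorObj Y X) k);
        (∀ N : ℕ, Literature.AlgebraicGeometry.Motives.IsSmoothProjective (2 * N * n) (pow (2 * N)) →
          B.W.motivatedClasses (2 * N * n) (pow (2 * N)) (N * n) ≤ B.W.algebraicClasses (pow (2 * N)) (N * n)))

/-- Stub 1 (the bet): motivated density `> 1/2`, frequently in `N`. [cite: Andre1996Motifs, Thm 0.4 and 0.6.2] -/
theorem stub_motivatedDensity : MotivatedDensity := by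
  sorry

/-- Stub 2: motivated ⊆ algebraic in the middle degree of the even self-powers
(standard-conjecture-`B` strength; André 1996 §0.3). [cite: Andre1996Motifs, §0.3] -/
theorem stub_motivatedLeAlgebraic : MotivatedLeAlgebraic := by
  sorry

/-! ## Name-keyed aliases of the two statements — the hypotheses of `AlgebraicDensity_of`
The native skeleton audit (`#h21_check_skeleton`) admits a hypothesis of the skeleton theorem only if its head
constant is a registered obligation or is NAMED like a declared stub; `__Registered.stub_X` is statement `X` under
the registered stub's short name (device of `Cruxes/MediumKernelNoGo/Lines/pencil_bracket_count.lean` and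
`Cruxes/LoopsToCrossings/Lines/br-sandwich-diagonal.lean`; the `__` namespace is an implementation detail, so the
audit's stub report resolves each `stub_…` to the sorried theorem above, not to its alias; the gate-reserved
`@[stub]` attribute is not written by a planner). -/
namespace __Registered

/-- Alias of `MotivatedDensity` keyed by the registered stub name. -/
abbrev stub_motivatedDensity : Prop := MotivatedDensity
/-- Alias of `MotivatedLeAlgebraic` keyed by the registered stub name. -/
abbrev stub_motivatedLeAlgebraic : Prop := MotivatedLeAlgebraic

end __Registered

/-- **Composition (real proof) — THE SKELETON THEOREM.** Motivated density and `A_mot ⊆ A` on the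
counted spaces give algebraic density: `(1/2+δ)·h_N ≤ dim A_mot^{nN}(X^{2N}) ≤ dim A^{nN}(X^{2N})`,
the last step by monotonicity of `finrank` in the finite-dimensional `H^{2nN}_B(X^{2N})`
(`WeilCohomology.finite_obj`). Hypotheses = the two stub statements (name-keyed aliases);
concludes the route decl `AlgebraicDensity` BY NAME. -/
theorem AlgebraicDensity_of :
    __Registered.stub_motivatedDensity → __Registered.stub_motivatedLeAlgebraic → AlgebraicDensity := by
  intro h1 h2 B hc n X hX
  obtain ⟨δ, hδ, hfreq⟩ := h1 B hc hX
  refine ⟨δ, hδ, hfreq.mono fun N => ?_⟩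
  rintro ⟨hN, hle⟩
  refine ⟨hN, hle.trans ?_⟩
  haveI := B.W.finite_obj hN (2 * (N * n))
  exact_mod_cast Submodule.finrank_mono (h2 B hc hX N hN)

/-- **The crux, closed modulo exactly the two registered stubs** (sanity: the stubs compose). -/
theorem AlgebraicDensity_of_stubs : AlgebraicDensity :=
  AlgebraicDensity_of stub_motivatedDensity stub_motivatedLeAlgebraic

end Summit.HodgeConjecture.HodgeConjecture.Cruxes.AlgebraicDensity.Birth
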